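import Summits.NavierStokesRegularity.NavierStokesRegularity.Theorems.TypeICertificateLadderTargetStrainCubeRung
import Summits.NavierStokesRegularity.NavierStokesRegularity.Theorems.TypeICertificateLadderLadderGlue
import HarnessLib

/-!
# Crux `Target` = `TypeICertificateLadder.NoTypeIBlowup` (stmt-NavierStokesRegularity-1217), line
# `depletion-ladder`: THE CRUX IS NOW EXACTLY THE DESCENT TO RUNG TWO (S3)

`--supports stmt-NavierStokesRegularity-1217` (bookkeeping file closing the logical position of the
line after RUNG TWO landed, `…StrainCubeRung.lean`).

* `target_of_descentToRungTwo` — **S3 ⇒ crux**: the registered residual stub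
  `stub_descentToRungTwo` of the skeleton of record `Cruxes/Target/Lines/depletion_ladder.lean`
  (VERBATIM after unfolding `DescentToRungTwo`: every Type-I(`C`), `C ≥ 2`, classical Leray–Hopf
  rapidly-decaying-datum solution that does not extend past `T` eventually has rate `≤ 2√ν`) ALONE
  implies the crux `ThreadingFlux.Target` = `NoTypeIBlowup` (VERBATIM), by the landed rung two
  (`rungTwo`) and the ladder glue (`typeICertificateLadder_ladderGlue_proof`). In the skeleton this
  is `noTypeIBlowup_of_rungTwo_of_descent` with its first argument now discharged.
* `descentToRungTwo_of_target` — conversely the crux gives S3 (vacuously), so **crux ↔ S3**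
  (`target_iff_descentToRungTwo`): the line `depletion-ladder` has delivered everything but its
  declared open residual (Type-I Liouville above collapse Reynolds number two).

WHAT THIS IS NOT: no new analysis; S3 is open. [folklore]
-/

noncomputable section

open Set Filter Topology
open Literature.Analysis.FluidPDE

namespace Summit.NavierStokesRegularity.NavierStokesRegularity.Theorems.DepletionLadder.StrainCube

-- the problem directory repeats the summit name (`NavierStokesRegularity/NavierStokesRegularity`)
set_option linter.dupNamespace false

/-- **S3 ⇒ crux.** If every Type-I(`C`) (`C ≥ 2`) classical Leray–Hopf rapidly-decaying-datum solution
that does not extend past `T` eventually has dimensionless rate `≤ 2`, then there is no Type-I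
blow-up at all (`ThreadingFlux.Target`, verbatim): raise the level to `max C 2`, descend, and extend
by `rungTwo`. [folklore] -/
theorem target_of_descentToRungTwo
    (hD2 : ∀ C : ℝ, 2 ≤ C → ∀ (ν T : ℝ), 0 < ν → 0 < T →
      ∀ (u : ℝ → EuclideanSpace ℝ (Fin 3) → EuclideanSpace ℝ (Fin 3))
        (p : ℝ → EuclideanSpace ℝ (Fin 3) → ℝ),
        IsClassicalNSSolutionOn (Set.Ico 0 T) ν 0 u p → IsLerayHopfOn T ν 0 (u 0) u →
        HasRapidSpatialDecay (u 0) →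
        (∀ᶠ t in 𝓝[<] T, ∀ x, Real.sqrt (T - t) * ‖u t x‖ ≤ C * Real.sqrt ν) →
        ¬ HasSmoothExtensionPast ν 0 u T →
        ∀ᶠ t in 𝓝[<] T, ∀ x, Real.sqrt (T - t) * ‖u t x‖ ≤ 2 * Real.sqrt ν) :
    ∀ (ν T : ℝ), 0 < ν → 0 < T →
      ∀ (u : ℝ → EuclideanSpace ℝ (Fin 3) → EuclideanSpace ℝ (Fin 3))
        (p : ℝ → EuclideanSpace ℝ (Fin 3) → ℝ),
        IsClassicalNSSolutionOn (Set.Ico 0 T) ν 0 u p → IsLerayHopfOn T ν 0 (u 0) u →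
        HasRapidSpatialDecay (u 0) → IsTypeIBlowup u T → HasSmoothExtensionPast ν 0 u T := by
  refine typeICertificateLadder_ladderGlue_proof fun C _ ν T hν hT u p hcl hLH hdec hrate => ?_
  by_contra hext
  have hrate' : ∀ᶠ t in 𝓝[<] T, ∀ x, Real.sqrt (T - t) * ‖u t x‖ ≤ max C 2 * Real.sqrt ν := by
    filter_upwards [hrate] with t ht
    intro x
    exact (ht x).trans (mul_le_mul_of_nonneg_right (le_max_left _ _) (Real.sqrt_nonneg ν))
  exact hext (rungTwo ν T hν hT u p hcl hLH hdec
    (hD2 (max C 2) (le_max_right _ _) ν T hν hT u p hcl hLH hdec hrate' hext))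

/-- **Crux ⇒ S3** (vacuously: under the crux no Type-I(`C`) solution fails to extend). [folklore] -/
theorem descentToRungTwo_of_target
    (hT : ∀ (ν T : ℝ), 0 < ν → 0 < T →
      ∀ (u : ℝ → EuclideanSpace ℝ (Fin 3) → EuclideanSpace ℝ (Fin 3))
        (p : ℝ → EuclideanSpace ℝ (Fin 3) → ℝ),
        IsClassicalNSSolutionOn (Set.Ico 0 T) ν 0 u p → IsLerayHopfOn T ν 0 (u 0) u →
        HasRapidSpatialDecay (u 0) → IsTypeIBlowup u T → HasSmoothExtensionPast ν 0 u T) :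
    ∀ C : ℝ, 2 ≤ C → ∀ (ν T : ℝ), 0 < ν → 0 < T →
      ∀ (u : ℝ → EuclideanSpace ℝ (Fin 3) → EuclideanSpace ℝ (Fin 3))
        (p : ℝ → EuclideanSpace ℝ (Fin 3) → ℝ),
        IsClassicalNSSolutionOn (Set.Ico 0 T) ν 0 u p → IsLerayHopfOn T ν 0 (u 0) u →
        HasRapidSpatialDecay (u 0) →
        (∀ᶠ t in 𝓝[<] T, ∀ x, Real.sqrt (T - t) * ‖u t x‖ ≤ C * Real.sqrt ν) →
        ¬ HasSmoothExtensionPast ν 0 u T →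
        ∀ᶠ t in 𝓝[<] T, ∀ x, Real.sqrt (T - t) * ‖u t x‖ ≤ 2 * Real.sqrt ν := by
  intro C _ ν T hν hT' u p hcl hLH hdec hrate hext
  refine absurd (hT ν T hν hT' u p hcl hLH hdec ⟨C * Real.sqrt ν, ?_⟩) hext
  have hlt : ∀ᶠ t in 𝓝[<] T, t < T := self_mem_nhdsWithin
  filter_upwards [hrate, hlt] with t ht htT
  intro x
  have hTt : 0 < Real.sqrt (T - t) := Real.sqrt_pos.2 (sub_pos.2 htT)
  rw [le_div_iff₀ hTt, mul_comm]
  exact ht x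

/-- **Crux ↔ S3**: after rung two, the crux `Target` of line `depletion-ladder` is exactly its
registered residual `stub_descentToRungTwo`. [folklore] -/
theorem target_iff_descentToRungTwo :
    (∀ (ν T : ℝ), 0 < ν → 0 < T →
      ∀ (u : ℝ → EuclideanSpace ℝ (Fin 3) → EuclideanSpace ℝ (Fin 3))
        (p : ℝ → EuclideanSpace ℝ (Fin 3) → ℝ),
        IsClassicalNSSolutionOn (Set.Ico 0 T) ν 0 u p → IsLerayHopfOn T ν 0 (u 0) u →
        HasRapidSpatialDecay (u 0) → IsTypeIBlowup u T → HasSmoothExtensionPast ν 0 u T) ↔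
    (∀ C : ℝ, 2 ≤ C → ∀ (ν T : ℝ), 0 < ν → 0 < T →
      ∀ (u : ℝ → EuclideanSpace ℝ (Fin 3) → EuclideanSpace ℝ (Fin 3))
        (p : ℝ → EuclideanSpace ℝ (Fin 3) → ℝ),
        IsClassicalNSSolutionOn (Set.Ico 0 T) ν 0 u p → IsLerayHopfOn T ν 0 (u 0) u →
        HasRapidSpatialDecay (u 0) →
        (∀ᶠ t in 𝓝[<] T, ∀ x, Real.sqrt (T - t) * ‖u t x‖ ≤ C * Real.sqrt ν) →
        ¬ HasSmoothExtensionPast ν 0 u T →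
        ∀ᶠ t in 𝓝[<] T, ∀ x, Real.sqrt (T - t) * ‖u t x‖ ≤ 2 * Real.sqrt ν) :=
  ⟨descentToRungTwo_of_target, target_of_descentToRungTwo⟩

end Summit.NavierStokesRegularity.NavierStokesRegularity.Theorems.DepletionLadder.StrainCube

end
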